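import Literature.NumberTheory.LFunctions.FordExpSumLargeLambda
import HarnessLib

/-!
# Ford's Richert-type bound for `ζ` (Theorem 1 of Ford 2002): decomposition into Theorems 3 and 4

Topic `Literature/NumberTheory/LFunctions`. SPLIT of the named fact
`Literature.NumberTheory.LFunctions.zeta_bound_ford` (`VinogradovKorobov.lean`; K. Ford,
*Vinogradov's integral and bounds for the Riemann zeta function*, Proc. London Math. Soc. (3) 85
(2002), 565–633, Theorem 1 with `A = 76.2`, `B = 4.45`) into the printed intermediate results it
rests on and that the tree does not yet prove:

* `ford2002_theorem3_row_ge_200`, `ford2002_theorem3_row_150_199`, `ford2002_theorem3_row_129_149` —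
  the three rows `(ρ, θ) = (3.21432, 2.3291)`, `(3.21734, 2.3849)`, `(3.22313, 2.4183)` of (1.7)
  (Theorem 3 of the source: explicit Vinogradov mean value theorem
  `J_{s,k}(P) ≤ k^{θk³} P^{2s − k(k+1)/2 + 0.001k²}` for some `s ≤ ρk²`), for `k ≥ 200`,
  `150 ≤ k ≤ 199`, `129 ≤ k ≤ 149` respectively — exactly the rows used in §5 of the source;
* `ford2002_theorem4` — Theorem 4 of the source (the bound for incomplete systems
  `J_{s,k,h}(𝒞(P, P^η))`), verbatim in the tree's notation `FordVK.Jinc`, `FordVK.calC`;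

and the PROVED assembly

* `zeta_bound_ford_holds_of` — the four children imply `zeta_bound_ford`.

The assembly is `zeta_bound_ford_of_theorem3_theorem4` (`FordExpSumLargeLambda.lean`), i.e. the
whole of §§2, 5, 6, 7 of the source is already a theorem of the tree: van der Corput for `λ ≤ 8`,
the certified rows of Table 6.1 for `8 ≤ λ ≤ 87` (`FordExpSumMidLambda.lean`), Theorem 2 for
`λ ≥ 87` from the rows of (1.7) and Theorem 4 (`FordLargeLambda.lean`, `FordLargeLambdaTail.lean`),
and §7 (`FordZetaBoundMain13.lean`, `FordZetaBoundKappa13*.lean`). In-tree progress on the children: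
the row `k ≥ 1191` of `ford2002_theorem3_row_ge_200` is proved from Lemma 3.4 of the source
(`FordP1.row_ge_1191`, `FordTheorem3LargeKOfLemma34.lean`, hypothesis `FordP1.Lemma34Hyp k 0.06`);
Lemmas 3.2, 3.3 and the prime windows of Lemma 2.1 are in `FordLemma32*.lean`, `FordLemma33A.lean`,
`FordPrimeWindowsPNT.lean`; §4 (Theorem 4) is begun in `FordIncomplete*.lean`.

## References

* K. Ford, *Vinogradov's integral and bounds for the Riemann zeta function*, Proc. London Math.
  Soc. (3) 85 (2002), 565–633; arXiv:1910.08209 — Theorem 1, Theorem 3 with (1.7), Theorem 4,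
  §5 (Lemmas 5.2–5.3), §7. [Ford2002]
-/

noncomputable section

open Finset

namespace Literature.NumberTheory.LFunctions

/-! ## The children (named facts) -/

/-- NAMED FACT (Ford 2002, Theorem 3, the row `k ≥ 200` of (1.7): `(ρ, θ) = (3.21432, 2.3291)`).
For every integer `k ≥ 200` there is an integer `s` with `1 ≤ s ≤ 3.21432 k²` such that for all
`P ≥ 1`, `J_{s,k}(P) ≤ k^{2.3291 k³} · P^{2s − k(k+1)/2 + 0.001 k²}`, where `J_{s,k}(P) = VMV.J k s [1, P]`
is Vinogradov's integral (the number of solutions of the Vinogradov system of degree `k` in `2s`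
variables from `[1, P]`). Users take `(h : ford2002_theorem3_row_ge_200)`.
[cite: Ford2002, Theorem 3 and (1.7), row k ≥ 200] -/
def ford2002_theorem3_row_ge_200 : Prop :=
  ∀ k : ℕ, 200 ≤ k → ∃ s₃ : ℕ, 1 ≤ s₃ ∧ (s₃ : ℝ) ≤ 3.21432 * (k : ℝ) ^ 2 ∧ ∀ P : ℕ, 1 ≤ P →
    (VMV.J k s₃ (Finset.Icc (1 : ℤ) P) : ℝ) ≤ (k : ℝ) ^ (2.3291 * (k : ℝ) ^ 3)
      * (P : ℝ) ^ ((2 * s₃ : ℝ) - ((k * (k + 1) / 2 : ℕ) : ℝ) + 0.001 * (k : ℝ) ^ 2)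

/-- NAMED FACT (Ford 2002, Theorem 3, the row `150 ≤ k ≤ 199` of (1.7):
`(ρ, θ) = (3.21734, 2.3849)`). For every integer `150 ≤ k ≤ 199` there is an integer `s` with
`1 ≤ s ≤ 3.21734 k²` such that for all `P ≥ 1`,
`J_{s,k}(P) ≤ k^{2.3849 k³} · P^{2s − k(k+1)/2 + 0.001 k²}`. Users take
`(h : ford2002_theorem3_row_150_199)`. [cite: Ford2002, Theorem 3 and (1.7), row 150 ≤ k ≤ 199] -/
def ford2002_theorem3_row_150_199 : Prop :=
  ∀ k : ℕ, 150 ≤ k → k ≤ 199 → ∃ s₃ : ℕ, 1 ≤ s₃ ∧ (s₃ : ℝ) ≤ 3.21734 * (k : ℝ) ^ 2 ∧ ∀ P : ℕ, 1 ≤ P →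
    (VMV.J k s₃ (Finset.Icc (1 : ℤ) P) : ℝ) ≤ (k : ℝ) ^ (2.3849 * (k : ℝ) ^ 3)
      * (P : ℝ) ^ ((2 * s₃ : ℝ) - ((k * (k + 1) / 2 : ℕ) : ℝ) + 0.001 * (k : ℝ) ^ 2)

/-- NAMED FACT (Ford 2002, Theorem 3, the row `129 ≤ k ≤ 149` of (1.7):
`(ρ, θ) = (3.22313, 2.4183)`). For every integer `129 ≤ k ≤ 149` there is an integer `s` with
`1 ≤ s ≤ 3.22313 k²` such that for all `P ≥ 1`,
`J_{s,k}(P) ≤ k^{2.4183 k³} · P^{2s − k(k+1)/2 + 0.001 k²}`. Users take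
`(h : ford2002_theorem3_row_129_149)`. [cite: Ford2002, Theorem 3 and (1.7), row 129 ≤ k ≤ 149] -/
def ford2002_theorem3_row_129_149 : Prop :=
  ∀ k : ℕ, 129 ≤ k → k ≤ 149 → ∃ s₃ : ℕ, 1 ≤ s₃ ∧ (s₃ : ℝ) ≤ 3.22313 * (k : ℝ) ^ 2 ∧ ∀ P : ℕ, 1 ≤ P →
    (VMV.J k s₃ (Finset.Icc (1 : ℤ) P) : ℝ) ≤ (k : ℝ) ^ (2.4183 * (k : ℝ) ^ 3)
      * (P : ℝ) ^ ((2 * s₃ : ℝ) - ((k * (k + 1) / 2 : ℕ) : ℝ) + 0.001 * (k : ℝ) ^ 2)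

/-- NAMED FACT (Ford 2002, Theorem 4: Vinogradov's integral for incomplete systems). Let `k ≥ 60`,
`0.9k ≤ h ≤ k − 2`, `2(k−h+1) ≤ s ≤ (h/2)(k−h+1)`, `D ≥ 10`, `P ≥ e^{Dk²}`, `2/k³ < η ≤ 1/(2k)`,
and put `ω := 4 log k/(Dk²η)` with `18/k ≤ ω ≤ 0.4`. Then the number `J_{s,k,h}(𝒞(P, P^η))` of
solutions of the incomplete system (equations of degrees `h, …, k`) with variables in Ford's set
`𝒞(P, P^η)` of integers `n ≤ P` all of whose prime factors lie in `(P^{η/2}, P^η]` satisfies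
`J_{s,k,h}(𝒞(P,P^η)) ≤ exp(s²/(k−h+1) + 10.5(k−h+1) log²k/(Dkη²) − s((1/η + h)(1−1/h)^{s/(k−h+1)} − h) log(1/(10η)))
  · P^{2s − (k−h+1)(h+k)/2 + (k−h+1)(k−h)/2 + ηs²/(2(k−h+1)) + h(k−h+1) e^{−s/(h(k−h+1))}}`,
in the tree's notation `FordVK.Jinc k s (𝒞.map Nat.castEmbedding) h k`, `FordVK.calC P (P^η)`
(`FordVinogradovZRD.lean`, `FordRoughNumbers.lean`). Users take `(h : ford2002_theorem4)`. [cite: Ford2002, Theorem 4] -/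
def ford2002_theorem4 : Prop :=
  ∀ (k h s : ℕ) (P η D : ℝ), 60 ≤ k → (0.9 : ℝ) * k ≤ h → h + 2 ≤ k →
    2 * (k - h + 1) ≤ s → s ≤ (h / 2) * (k - h + 1) → 10 ≤ D → Real.exp (D * (k : ℝ) ^ 2) ≤ P →
    2 / (k : ℝ) ^ 3 < η → η ≤ 1 / (2 * (k : ℝ)) →
    18 / (k : ℝ) ≤ 4 * Real.log k / (D * (k : ℝ) ^ 2 * η) →
    4 * Real.log k / (D * (k : ℝ) ^ 2 * η) ≤ 0.4 →
    (FordVK.Jinc k s ((FordVK.calC P (P ^ η)).map Nat.castEmbedding) h k : ℝ)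
      ≤ Real.exp ((s : ℝ) ^ 2 / ((k : ℝ) - h + 1)
          + 10.5 * ((k : ℝ) - h + 1) * Real.log k ^ 2 / (D * k * η ^ 2)
          - s * ((1 / η + h) * (1 - 1 / (h : ℝ)) ^ ((s : ℝ) / ((k : ℝ) - h + 1)) - h)
            * Real.log (1 / (10 * η)))
        * P ^ ((2 * s : ℝ) - ((k : ℝ) - h + 1) / 2 * (h + k) + ((k : ℝ) - h + 1) * ((k : ℝ) - h) / 2
          + η * (s : ℝ) ^ 2 / (2 * ((k : ℝ) - h + 1))
          + h * ((k : ℝ) - h + 1) * Real.exp (-(s : ℝ) / (h * ((k : ℝ) - h + 1))))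

/-! ## The assembly (proved) -/

/-- **Ford's Theorem 1 from its printed inputs (SPLIT assembly).** The three rows `k ≥ 129` of
(1.7) (Theorem 3) and Theorem 4 of [Ford2002] imply `zeta_bound_ford`
(`|ζ(σ+it)| ≤ 76.2 t^{4.45(1−σ)^{3/2}} (log t)^{2/3}`, `t ≥ 3`, `1/2 ≤ σ ≤ 1`); everything else
(§§2, 5, 6, 7 of the source) is proved in the tree (`zeta_bound_ford_of_theorem3_theorem4`).
[cite: Ford2002, Theorem 1 (proof, §7), Theorem 2 (§§5–6)] -/
theorem zeta_bound_ford_holds_of (h₁ : ford2002_theorem3_row_ge_200)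
    (h₂ : ford2002_theorem3_row_150_199) (h₃ : ford2002_theorem3_row_129_149)
    (h₄ : ford2002_theorem4) : zeta_bound_ford :=
  zeta_bound_ford_of_theorem3_theorem4 h₁ h₂ h₃ h₄

end Literature.NumberTheory.LFunctions
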